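import Summits.ABC.StewartYu.PadicTwistValues
import Literature.NumberTheory.Transcendental.PadicCW77Functions
import HarnessLib

/-!
# Cell abc-stewartyu, WP-Y3 (iii): the auxiliary functions `f_{J,τ}`, `φ_{J,τ}` of the TWISTED
# `p`-adic set-up

`Summits/ABC/StewartYu/PadicTwistFunctions.lean` — cell `abc-stewartyu` (seat p2; crux
`YuNinetyThreeModFour` stmt-ABC-19249, line `twist-w80`), sequel to `PadicTwistValues.lean`.
Plain definitions and theorems; no named fact.  TWIN of p2's `PadicCW77Functions.lean` (principal
units) for `S : TwistSetup p` (arbitrary rational units twisted by roots of unity of odd order):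
the SAME functions built on the logarithms `log_p ωᵢ` of the twisted principal units `ωᵢ` —
`wOf`, `Dw` (the `Δ`-factor, rational at rational points: `Dw_natCast`, `Dw_ratCast`),
`A = ∏ γⱼ^{τ'ⱼ}`, `termF`, `termΦ`, `F = ∑ p(u) termF` (`f_{J,τ}`), `Φ = ∑ p(u) termΦ` (`φ_{J,τ}`),
the differential equations `hasDerivAt_F`, the loss-free control of derivatives by values
`norm_iteratedDeriv_F_le_of_forall`, the unit-disc size `norm_F_le` and the ultrametric Lemma 9
`norm_F_sub_Φ_le` — all proofs verbatim.  The ONE difference is at the integer points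
[Yu 1990, (2.61)–(2.63)]: `termΦ(s) = (cls u)ˢ · qTerm(u,s)` and, on a box whose unknowns share the
class value `ρ` (on the support of `p`), `φ_{J,τ}(s) = ρˢ · coreSum(s)` (`Φ_natCast`) — so
`‖φ_{J,τ}(s)‖ = ‖coreSum(s)‖_p` (`norm_Φ_natCast`), which is all the rational Liouville step of the
k-step needs.

## References
* [Yu1990] K. Yu, *Linear forms in p-adic logarithms II*, Compositio Math. 74 (1990), §§2.3–2.4.
* [CijsouwWaldschmidt1977] P. L. Cijsouw, M. Waldschmidt, Compositio Math. 34 (1977), §4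
  (pp. 184–188: the functions, Lemma 9, the differential equations).
-/

noncomputable section

open NormedSpace Finset IsUltrametricDist Polynomial Metric
open Literature.NumberTheory.Transcendental
open Literature.NumberTheory.Transcendental.Baker1975 (bump bump_apply sum_bump)
open Literature.NumberTheory.Transcendental.Baker1975.Ch3 (wPoly Qw)
open Literature.NumberTheory.Transcendental.PadicCW77.Setup (DwQ)
open scoped Nat Topology

namespace Summit.ABC.StewartYu

open Literature.NumberTheory.Transcendental.CW77.Setup (Idx Tau tauNorm bump0 bumpj bumpτ tauNorm_bumpτ bumpτ_zero bumpτ_succ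
  Qw_zero_right)

namespace TwistSetup

variable {p : ℕ} [Fact p.Prime] (S : TwistSetup p) {h Lb : ℕ}


/-! ### The `Δ`-polynomial and its rational values -/

/-- **The rational identity** `DwQ (2^{J₀−J}) r l h τ₀ s = qΔ` for ANY frame `F : CW77.Setup`
(transported from the complex identity `CW77.Setup.Qw_wOf_natCast` through `ℚ ↪ ℂ`; p2's
`PadicCW77.Setup.DwQ_eq_qΔ` is the case of the frame of a principal-unit set-up).
[cite: CijsouwWaldschmidt1977, §4 (9) (p. 184)] -/
theorem DwQ_eq_qΔ_frame (F : CW77.Setup) {h Lb : ℕ} (J₀ J : ℕ) (u : Idx F.d h Lb) (τ₀ s : ℕ) :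
    DwQ (2 ^ (J₀ - J)) (u.1.1 : ℕ) (u.1.2 : ℕ) h τ₀ (s : ℚ) = F.qΔ J₀ J u τ₀ s := by
  apply Rat.cast_injective (α := ℂ)
  have h1 := F.Qw_wOf_natCast J₀ J u τ₀ s
  rw [Qw_zero_right] at h1
  rw [← h1]
  unfold PadicCW77.Setup.DwQ CW77.Setup.wOf
  rw [← Waldschmidt1980.map_wScaled, iterate_derivative_map, Polynomial.eval_map,
    Polynomial.eval₂_at_natCast]
  simp

/-- **The `Δ`-polynomial of `u` at level `J`** over `ℚ_p`: `w_ρ(2^{J₀−J} X) ∈ ℚ_p[X]`.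
[cite: CijsouwWaldschmidt1977, §4 (p. 186)] -/
def wOf (J₀ J : ℕ) (u : Idx S.d h Lb) : ℚ_[p][X] :=
  (Waldschmidt1980.wScaled (2 ^ (J₀ - J)) (u.1.1 : ℕ) (u.1.2 : ℕ) h).map (algebraMap ℚ ℚ_[p])

/-- The `Δ`-factor `Dw τ₀ z = (d/dz)^{τ₀} [w_ρ(2^{J₀−J} z)]`. [cite: CijsouwWaldschmidt1977, §4 (p. 186)] -/
def Dw (J₀ J : ℕ) (u : Idx S.d h Lb) (τ₀ : ℕ) (z : ℚ_[p]) : ℚ_[p] :=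
  (derivative^[τ₀] (S.wOf J₀ J u)).eval z

/-- **`Dw τ₀ s = qΔ`** at a natural number `s`. [cite: CijsouwWaldschmidt1977, §4 (9) (p. 184)] -/
theorem Dw_natCast (J₀ J : ℕ) (u : Idx S.d h Lb) (τ₀ s : ℕ) :
    S.Dw J₀ J u τ₀ (s : ℚ_[p]) = (S.frame.qΔ J₀ J u τ₀ s : ℚ_[p]) := by
  rw [← DwQ_eq_qΔ_frame S.frame]
  unfold Dw wOf PadicCW77.Setup.DwQ
  rw [iterate_derivative_map, Polynomial.eval_map,
    show ((s : ℕ) : ℚ_[p]) = algebraMap ℚ ℚ_[p] (s : ℚ) by simp, Polynomial.eval₂_at_apply]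
  rfl

/-- **`Dw τ₀ x = DwQ … x`** at any RATIONAL point `x` (e.g. the half-integers `s/2` of the
descent: the `Δ`-factor takes rational values there). [cite: CijsouwWaldschmidt1977, §4 (p. 189)] -/
theorem Dw_ratCast (J₀ J : ℕ) (u : Idx S.d h Lb) (τ₀ : ℕ) (x : ℚ) :
    S.Dw J₀ J u τ₀ (x : ℚ_[p]) = (DwQ (2 ^ (J₀ - J)) (u.1.1 : ℕ) (u.1.2 : ℕ) h τ₀ x : ℚ_[p]) := by
  unfold Dw wOf PadicCW77.Setup.DwQ
  rw [iterate_derivative_map, Polynomial.eval_map,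
    show ((x : ℚ) : ℚ_[p]) = algebraMap ℚ ℚ_[p] x from rfl, Polynomial.eval₂_at_apply]
  rfl

/-- `d/dz Dw τ₀ = Dw (τ₀+1)`. [cite: CijsouwWaldschmidt1977, §4 (pp. 186–188)] -/
theorem hasDerivAt_Dw (J₀ J : ℕ) (u : Idx S.d h Lb) (τ₀ : ℕ) (z : ℚ_[p]) :
    HasDerivAt (S.Dw J₀ J u τ₀) (S.Dw J₀ J u (τ₀ + 1) z) z := by
  unfold Dw
  rw [Function.iterate_succ_apply']
  exact Polynomial.hasDerivAt _ z

/-! ### The functions -/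

/-- `A(u, τ') = ∏ⱼ γⱼ^{τ'ⱼ} ∈ ℚ_p`. [cite: CijsouwWaldschmidt1977, §4 (p. 185)] -/
def A (u : Idx S.d h Lb) (τ' : Fin S.d → ℕ) : ℚ_[p] := ∏ j, (S.frame.γ u j : ℚ_[p]) ^ τ' j

/-- `A = qA` (cast). [cite: CijsouwWaldschmidt1977, §4 (pp. 186–188)] -/
theorem A_eq (u : Idx S.d h Lb) (τ' : Fin S.d → ℕ) : S.A u τ' = (S.frame.qA u τ' : ℚ_[p]) := by
  unfold A CW77.Setup.qA; push_cast; rfl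

/-- `‖A(u,τ')‖ ≤ 1`. [cite: CijsouwWaldschmidt1977, §4 (pp. 186–188)] -/
theorem norm_A_le (τ' : Fin S.d → ℕ) (u : Idx S.d h Lb) : ‖S.A u τ'‖ ≤ 1 := by
  rw [S.A_eq]; exact S.norm_qA_le u τ'

/-- `A(u, τ' + eⱼ) = A(u, τ') · γⱼ`. [cite: CijsouwWaldschmidt1977, §4 (pp. 186–188)] -/
theorem A_bump (u : Idx S.d h Lb) (τ' : Fin S.d → ℕ) (j : Fin S.d) :
    S.A u (bump τ' j) = S.A u τ' * (S.frame.γ u j : ℚ_[p]) := by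
  unfold A
  have hj : ∀ j' : Fin S.d, (S.frame.γ u j' : ℚ_[p]) ^ bump τ' j j' =
      (S.frame.γ u j' : ℚ_[p]) ^ τ' j' * (if j' = j then (S.frame.γ u j : ℚ_[p]) else 1) := by
    intro j'
    rw [bump_apply, pow_add]
    congr 1
    by_cases hjj : j' = j
    · subst hjj; simp
    · rw [if_neg hjj, if_neg hjj, pow_zero]
  simp_rw [hj]
  rw [prod_mul_distrib, prod_ite_eq' univ j, if_pos (mem_univ j)]

/-- One term of `f_{J,τ}`: `Dw τ₀ z · A(u,τ') · exp(expo(u) z)`. [cite: CijsouwWaldschmidt1977, §4 (p. 186)] -/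
def termF (J₀ J : ℕ) (u : Idx S.d h Lb) (τ : Tau S.d) (z : ℚ_[p]) : ℚ_[p] :=
  S.Dw J₀ J u τ.1 z * S.A u τ.2 * exp (S.expo u * z)

/-- One term of `φ_{J,τ}`: the same with the exact exponent `ψ_u`. [cite: CijsouwWaldschmidt1977, §4 (p. 186)] -/
def termΦ (J₀ J : ℕ) (u : Idx S.d h Lb) (τ : Tau S.d) (z : ℚ_[p]) : ℚ_[p] :=
  S.Dw J₀ J u τ.1 z * S.A u τ.2 * exp (S.ψ u * z)

/-- **`f_{J,τ}(z) = ∑_{u ∈ box} p(u) · termF`**. [cite: CijsouwWaldschmidt1977, §4 (p. 186)] -/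
def F (J₀ J : ℕ) (box : Finset (Idx S.d h Lb)) (pv : Idx S.d h Lb → ℤ) (τ : Tau S.d)
    (z : ℚ_[p]) : ℚ_[p] :=
  ∑ u ∈ box, (pv u : ℚ_[p]) * S.termF J₀ J u τ z

/-- **`φ_{J,τ}(z) = ∑_{u ∈ box} p(u) · termΦ`**. [cite: CijsouwWaldschmidt1977, §4 (p. 186)] -/
def Φ (J₀ J : ℕ) (box : Finset (Idx S.d h Lb)) (pv : Idx S.d h Lb → ℤ) (τ : Tau S.d)
    (z : ℚ_[p]) : ℚ_[p] :=
  ∑ u ∈ box, (pv u : ℚ_[p]) * S.termΦ J₀ J u τ z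

/-! ### The values of `φ` at natural numbers -/

/-- **`termΦ(s) = (cls u)ˢ · qTerm`** at a natural number `s`: the twist shows as the class value.
[cite: Yu1990, §2.3 (2.61)] -/
theorem termΦ_natCast (J₀ J : ℕ) (u : Idx S.d h Lb) (τ : Tau S.d) (s : ℕ) :
    S.termΦ J₀ J u τ (s : ℚ_[p]) = S.cls u ^ s * (S.toQ.qTerm J₀ J u τ s : ℚ_[p]) := by
  unfold termΦ SetupQ.qTerm
  rw [S.Dw_natCast, S.A_eq, S.exp_ψ_natCast]
  push_cast; ring

/-- **On a class, `φ_{J,τ}(s) = ρˢ · coreSum(s)`** at a natural number `s`: if every unknown of the box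
carrying a non-zero coefficient has the class value `ρ`, the value of `φ` is the RATIONAL core up to the
root of unity `ρˢ`. [cite: Yu1990, §2.3 (2.61)–(2.63)] -/
theorem Φ_natCast (J₀ J : ℕ) (box : Finset (Idx S.d h Lb)) (pv : Idx S.d h Lb → ℤ) (τ : Tau S.d)
    {ρ : ℚ_[p]} (hcls : ∀ u ∈ box, pv u ≠ 0 → S.cls u = ρ) (s : ℕ) :
    S.Φ J₀ J box pv τ (s : ℚ_[p]) = ρ ^ s * (S.toQ.coreSum J₀ J box pv τ s : ℚ_[p]) := by
  unfold Φ SetupQ.coreSum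
  push_cast
  rw [mul_sum]
  refine sum_congr rfl fun u hu => ?_
  by_cases h0 : pv u = 0
  · rw [h0]; simp
  · rw [S.termΦ_natCast, hcls u hu h0]; ring

/-- **On a class, `‖φ_{J,τ}(s)‖ = ‖coreSum(s)‖_p`** (`ρ^G = 1`, so `‖ρ‖ = 1`). [cite: Yu1990, §2.3 (2.63)] -/
theorem norm_Φ_natCast (J₀ J : ℕ) (box : Finset (Idx S.d h Lb)) (pv : Idx S.d h Lb → ℤ) (τ : Tau S.d)
    {ρ : ℚ_[p]} (hcls : ∀ u ∈ box, pv u ≠ 0 → S.cls u = ρ) (hρ : ρ ^ S.G = 1) (s : ℕ) :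
    ‖S.Φ J₀ J box pv τ (s : ℚ_[p])‖ = ‖(S.toQ.coreSum J₀ J box pv τ s : ℚ_[p])‖ := by
  have hn : ‖ρ‖ = 1 := by
    have h := congrArg (‖·‖) hρ
    simp only [norm_pow, norm_one] at h
    exact (pow_eq_one_iff_of_nonneg (norm_nonneg _) S.hG.ne').mp h
  rw [S.Φ_natCast J₀ J box pv τ hcls s, norm_mul, norm_pow, hn, one_pow, one_mul]

/-! ### Analyticity and the differential equations on `‖z‖ < √p` -/

/-- `‖√p‖`-facts: `0 < √p` and `(√p)⁻¹ · √p = 1`. [cite: CijsouwWaldschmidt1977, §4 (pp. 186–188)] -/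
theorem sqrt_p_pos (S : TwistSetup p) : 0 < Real.sqrt p := Real.sqrt_pos.mpr (by linarith [S.one_lt_p])

/-- For `‖z‖ < √p` and `‖c‖ ≤ p⁻¹`, the point `c z` lies in the disc of convergence of `exp`.
[cite: Yu1990, §1.1] -/
theorem mem_eball_of_norm_lt (S : TwistSetup p) {c z : ℚ_[p]} (hc : ‖c‖ ≤ (p : ℝ)⁻¹) (hz : ‖z‖ < Real.sqrt p) :
    z • c ∈ eball (0 : ℚ_[p]) (expSeries ℚ_[p] ℚ_[p]).radius := by
  have hp0 : (0 : ℝ) < p := by linarith [S.one_lt_p]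
  rw [mem_eball_zero_iff]
  refine lt_of_lt_of_le ?_ (PadicExp.inv_sqrt_le_expSeries_radius (ℓ := p) S.hp3)
  rw [enorm_eq_nnnorm, ENNReal.coe_lt_coe, ← NNReal.coe_lt_coe, coe_nnnorm, NNReal.coe_inv,
    Real.coe_sqrt, NNReal.coe_natCast, smul_eq_mul, norm_mul]
  calc ‖z‖ * ‖c‖ ≤ ‖z‖ * (p : ℝ)⁻¹ := mul_le_mul_of_nonneg_left hc (norm_nonneg _)
    _ < Real.sqrt p * (p : ℝ)⁻¹ := mul_lt_mul_of_pos_right hz (by positivity)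
    _ = (Real.sqrt p)⁻¹ := by
        refine eq_inv_of_mul_eq_one_left ?_
        rw [mul_right_comm, Real.mul_self_sqrt hp0.le, mul_inv_cancel₀ hp0.ne']

/-- `d/dz exp(c z) = c exp(c z)` for `‖c‖ ≤ p⁻¹`, `‖z‖ < √p`. [cite: Yu1990, §1.1] -/
theorem hasDerivAt_exp_mul (S : TwistSetup p) {c z : ℚ_[p]} (hc : ‖c‖ ≤ (p : ℝ)⁻¹) (hz : ‖z‖ < Real.sqrt p) :
    HasDerivAt (fun x : ℚ_[p] => exp (c * x)) (c * exp (c * z)) z := by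
  have hd := hasDerivAt_exp_smul_const_of_mem_ball' (𝕂 := ℚ_[p]) c z (S.mem_eball_of_norm_lt hc hz)
  have e1 : (fun u : ℚ_[p] => exp (u • c)) = fun u : ℚ_[p] => exp (c * u) := by
    funext u; rw [smul_eq_mul, mul_comm]
  rw [e1, smul_eq_mul, mul_comm z c] at hd
  exact hd

/-- `z ↦ exp(c z)` is analytic at `z` for `‖c‖ ≤ p⁻¹`, `‖z‖ < √p`. [cite: Yu1990, §1.1] -/
theorem analyticAt_exp_mul (S : TwistSetup p) {c z : ℚ_[p]} (hc : ‖c‖ ≤ (p : ℝ)⁻¹) (hz : ‖z‖ < Real.sqrt p) :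
    AnalyticAt ℚ_[p] (fun x : ℚ_[p] => exp (c * x)) z := by
  have h1 : AnalyticAt ℚ_[p] (exp : ℚ_[p] → ℚ_[p]) (c * z) := by
    refine analyticAt_exp_of_mem_ball (c * z) ?_
    have := S.mem_eball_of_norm_lt hc hz
    rwa [smul_eq_mul, mul_comm] at this
  have h2 : AnalyticAt ℚ_[p] (fun x : ℚ_[p] => c * x) z := by fun_prop
  exact h1.comp h2

/-- **The derivative of one term**: `d/dz termF_τ = termF_{τ+e₀} + ∑ⱼ (log_p αⱼ) · termF_{τ+eⱼ}`
on `‖z‖ < √p`. [cite: CijsouwWaldschmidt1977, §4 (p. 188), the differential equations] -/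
theorem hasDerivAt_termF (J₀ J : ℕ) (u : Idx S.d h Lb) (τ : Tau S.d) {z : ℚ_[p]}
    (hz : ‖z‖ < Real.sqrt p) :
    HasDerivAt (S.termF J₀ J u τ)
      (S.termF J₀ J u (bump0 τ) z + ∑ j : Fin S.d, S.lg j * S.termF J₀ J u (bumpj τ j) z) z := by
  have h1 := S.hasDerivAt_Dw J₀ J u τ.1 z
  have h2 : HasDerivAt (fun x => S.A u τ.2 * exp (S.expo u * x))
      (S.A u τ.2 * (S.expo u * exp (S.expo u * z))) z :=
    (S.hasDerivAt_exp_mul (S.norm_expo_le u) hz).const_mul _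
  have hsplit : S.termF J₀ J u τ = fun x => S.Dw J₀ J u τ.1 x * (S.A u τ.2 * exp (S.expo u * x)) := by
    funext x; simp only [termF]; ring
  rw [hsplit]
  refine (h1.mul h2).congr_deriv ?_
  have er : ∀ j : Fin S.d, S.lg j * S.termF J₀ J u (bumpj τ j) z =
      S.Dw J₀ J u τ.1 z * (S.A u τ.2 * exp (S.expo u * z)) * ((S.frame.γ u j : ℚ_[p]) * S.lg j) := by
    intro j
    simp only [termF, bumpj]
    rw [S.A_bump]
    ring
  simp_rw [er]
  rw [← mul_sum, ← S.expo_eq]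
  simp only [termF, bump0]
  ring

/-- `lg j` is `lgAll (castSucc j)`. [folklore] -/
theorem lg_eq_lgAll (j : Fin S.d) : S.lg j = S.lgAll (Fin.castSucc j) := rfl

/-- The coefficients of the differential equation: `1` in the `Δ`-direction, `log_p αⱼ` in the
direction of `αⱼ`; all of norm `≤ 1`. [cite: CijsouwWaldschmidt1977, §4 (p. 188)] -/
def dcoef (i : Fin (S.d + 1)) : ℚ_[p] := Fin.cases (1 : ℚ_[p]) (fun j => S.lg j) i

/-- `dcoef 0 · z = z` (`dcoef 0 = 1`; stated multiplicatively — the bare form is the tree's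
`CW77.Setup.dcoef_zero` over `ℂ`). [cite: CijsouwWaldschmidt1977, §4 (pp. 186–188)] -/
@[simp] theorem dcoef_zero_mul (z : ℚ_[p]) : S.dcoef 0 * z = z := one_mul z

/-- `dcoef (j+1) = log_p αⱼ`. [cite: CijsouwWaldschmidt1977, §4 (pp. 186–188)] -/
@[simp] theorem dcoef_succ (j : Fin S.d) : S.dcoef j.succ = S.lgAll (Fin.castSucc j) := rfl

/-- `‖dcoef i‖ ≤ 1`, and `≤ p⁻¹` in the directions of the generators. [folklore] -/
theorem norm_dcoef_le (i : Fin (S.d + 1)) : ‖S.dcoef i‖ ≤ 1 ∧ (i ≠ 0 → ‖S.dcoef i‖ ≤ (p : ℝ)⁻¹) := by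
  refine Fin.cases ?_ (fun j => ?_) i
  · refine ⟨?_, fun h => absurd rfl h⟩
    show ‖(1 : ℚ_[p])‖ ≤ 1
    simp
  · rw [S.dcoef_succ]
    exact ⟨(S.norm_lgAll_le _).trans S.inv_p_lt_one.le, fun _ => S.norm_lgAll_le _⟩

/-- **`d/dz f_{J,τ} = ∑ᵢ cᵢ f_{J,τ+eᵢ}`** on `‖z‖ < √p`. [cite: CijsouwWaldschmidt1977, §4 (p. 188)] -/
theorem hasDerivAt_F (J₀ J : ℕ) (box : Finset (Idx S.d h Lb)) (pv : Idx S.d h Lb → ℤ)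
    (τ : Tau S.d) {z : ℚ_[p]} (hz : ‖z‖ < Real.sqrt p) :
    HasDerivAt (S.F J₀ J box pv τ) (∑ i : Fin (S.d + 1), S.dcoef i * S.F J₀ J box pv (bumpτ τ i) z) z := by
  unfold F
  have h := HasDerivAt.fun_sum fun u (_ : u ∈ box) => (S.hasDerivAt_termF J₀ J u τ hz).const_mul (pv u : ℚ_[p])
  refine h.congr_deriv ?_
  simp only [Fin.sum_univ_succ, dcoef_zero_mul, dcoef_succ, bumpτ_zero, bumpτ_succ, mul_add,
    sum_add_distrib, mul_sum, lg_eq_lgAll]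
  congr 1
  rw [sum_comm]
  exact sum_congr rfl fun j _ => sum_congr rfl fun u _ => by ring

/-- `Dw` is smooth (a polynomial function). [cite: CijsouwWaldschmidt1977, §4 (pp. 186–188)] -/
theorem contDiffAt_Dw (J₀ J : ℕ) (u : Idx S.d h Lb) (τ₀ : ℕ) (n : WithTop ℕ∞) (z : ℚ_[p]) :
    ContDiffAt ℚ_[p] n (S.Dw J₀ J u τ₀) z := by
  have hc := (Polynomial.contDiff_aeval (𝕜 := ℚ_[p]) (derivative^[τ₀] (S.wOf J₀ J u)) n).contDiffAt
    (x := z)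
  have e : S.Dw J₀ J u τ₀ = fun x : ℚ_[p] => Polynomial.aeval x (derivative^[τ₀] (S.wOf J₀ J u)) := by
    funext x; unfold Dw; rw [Polynomial.coe_aeval_eq_eval]
  rw [e]; exact hc

/-- `f_{J,τ}` is smooth at every point of the disc `‖z‖ < √p`. [cite: CijsouwWaldschmidt1977, §4 (pp. 186–188)] -/
theorem contDiffAt_F (J₀ J : ℕ) (box : Finset (Idx S.d h Lb)) (pv : Idx S.d h Lb → ℤ) (τ : Tau S.d)
    (n : WithTop ℕ∞) {z : ℚ_[p]} (hz : ‖z‖ < Real.sqrt p) :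
    ContDiffAt ℚ_[p] n (S.F J₀ J box pv τ) z := by
  unfold F termF
  refine ContDiffAt.sum fun u _ => contDiffAt_const.mul ?_
  exact ((S.contDiffAt_Dw J₀ J u τ.1 n z).mul contDiffAt_const).mul
    (S.analyticAt_exp_mul (S.norm_expo_le u) hz).contDiffAt

/-- `deriv f_{J,τ} = ∑ᵢ cᵢ f_{J,τ+eᵢ}` near every point of `‖z‖ < √p`. [cite: CijsouwWaldschmidt1977, §4 (p. 188)] -/
theorem deriv_F_eventuallyEq (J₀ J : ℕ) (box : Finset (Idx S.d h Lb)) (pv : Idx S.d h Lb → ℤ)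
    (τ : Tau S.d) {a : ℚ_[p]} (ha : ‖a‖ < Real.sqrt p) :
    deriv (S.F J₀ J box pv τ) =ᶠ[𝓝 a] fun z => ∑ i : Fin (S.d + 1), S.dcoef i * S.F J₀ J box pv (bumpτ τ i) z := by
  have hball : {z : ℚ_[p] | ‖z‖ < Real.sqrt p} ∈ 𝓝 a := by
    have : {z : ℚ_[p] | ‖z‖ < Real.sqrt p} = Metric.ball 0 (Real.sqrt p) := by
      ext z; simp
    rw [this]
    exact Metric.isOpen_ball.mem_nhds (by simpa using ha)
  filter_upwards [hball] with z hz using (S.hasDerivAt_F J₀ J box pv τ hz).deriv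

/-- **The iterated derivatives**: `f_τ^{(k+1)}(a) = ∑ᵢ cᵢ f_{τ+eᵢ}^{(k)}(a)` (`‖a‖ < √p`).
[cite: CijsouwWaldschmidt1977, §4 (11) (p. 189)] -/
theorem iteratedDeriv_F_succ (J₀ J : ℕ) (box : Finset (Idx S.d h Lb)) (pv : Idx S.d h Lb → ℤ)
    (τ : Tau S.d) {a : ℚ_[p]} (ha : ‖a‖ < Real.sqrt p) (k : ℕ) :
    iteratedDeriv (k + 1) (S.F J₀ J box pv τ) a =
      ∑ i : Fin (S.d + 1), S.dcoef i * iteratedDeriv k (S.F J₀ J box pv (bumpτ τ i)) a := by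
  rw [iteratedDeriv_succ', (S.deriv_F_eventuallyEq J₀ J box pv τ ha).iteratedDeriv_eq k,
    iteratedDeriv_fun_sum fun i _ => contDiffAt_const.mul (S.contDiffAt_F J₀ J box pv (bumpτ τ i) k ha)]
  refine sum_congr rfl fun i _ => ?_
  exact iteratedDeriv_const_mul _ (S.contDiffAt_F J₀ J box pv (bumpτ τ i) k ha)

/-- **Derivatives are controlled by values, without loss** (ultrametric form of (10) ⇒ (11),
pp. 188–189): if `‖f_{J,τ'}(a)‖ ≤ ε` whenever `|τ'| ≤ N`, then `‖f_{J,τ}^{(k)}(a)‖ ≤ ε` whenever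
`|τ| + k ≤ N` (`‖a‖ < √p`; the coefficients `1, log_p αⱼ` have norm `≤ 1`).
[cite: CijsouwWaldschmidt1977, §4 (11) (p. 189)] [cite: Yu1990, Lemma 2.4] -/
theorem norm_iteratedDeriv_F_le_of_forall (J₀ J : ℕ) (box : Finset (Idx S.d h Lb))
    (pv : Idx S.d h Lb → ℤ) {a : ℚ_[p]} (ha : ‖a‖ < Real.sqrt p) (N : ℕ) {ε : ℝ} (hε0 : 0 ≤ ε)
    (hε : ∀ τ : Tau S.d, tauNorm τ ≤ N → ‖S.F J₀ J box pv τ a‖ ≤ ε) :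
    ∀ (k : ℕ) (τ : Tau S.d), tauNorm τ + k ≤ N → ‖iteratedDeriv k (S.F J₀ J box pv τ) a‖ ≤ ε := by
  intro k
  induction k with
  | zero => intro τ hτ; simpa using hε τ (by simpa using hτ)
  | succ k ih =>
    intro τ hτ
    rw [S.iteratedDeriv_F_succ J₀ J box pv τ ha k]
    refine IsUltrametricDist.norm_sum_le_of_forall_le_of_nonneg hε0 fun i _ => ?_
    rw [norm_mul]
    refine (mul_le_of_le_one_left (norm_nonneg _) (S.norm_dcoef_le i).1).trans (ih _ ?_)
    rw [tauNorm_bumpτ]; omega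

/-! ### Sizes on the unit disc, and Lemma 9 -/

/-- **Size of `f_{J,τ}` on the unit disc**: `‖f_{J,τ}(z)‖ ≤ Q` if `‖Dw(u,τ₀,z)‖ ≤ Q` on the box
(`p(u) ∈ ℤ`, `‖A‖ ≤ 1`, `‖exp(expo z)‖ = 1`). [cite: Yu1990, Lemma 2.2] -/
theorem norm_F_le (J₀ J : ℕ) (box : Finset (Idx S.d h Lb)) (pv : Idx S.d h Lb → ℤ) (τ : Tau S.d)
    {z : ℚ_[p]} (hz : ‖z‖ ≤ 1) {Q : ℝ} (hQ0 : 0 ≤ Q)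
    (hQ : ∀ u ∈ box, ‖S.Dw J₀ J u τ.1 z‖ ≤ Q) : ‖S.F J₀ J box pv τ z‖ ≤ Q := by
  unfold F
  refine IsUltrametricDist.norm_sum_le_of_forall_le_of_nonneg hQ0 fun u hu => ?_
  have hez : ‖S.expo u * z‖ ≤ (p : ℝ)⁻¹ := by
    rw [norm_mul]
    exact (mul_le_of_le_one_right (norm_nonneg _) hz).trans (S.norm_expo_le u)
  rw [norm_mul, termF, norm_mul, norm_mul, PadicExp.norm_exp_of_norm_le S.hp3 hez, mul_one]
  calc ‖(pv u : ℚ_[p])‖ * (‖S.Dw J₀ J u τ.1 z‖ * ‖S.A u τ.2‖)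
      ≤ 1 * (Q * 1) := by
        refine mul_le_mul (Padic.norm_int_le_one _) ?_ (by positivity) zero_le_one
        exact mul_le_mul (hQ u hu) (S.norm_A_le τ.2 u) (norm_nonneg _) hQ0
    _ = Q := by ring

/-- **Lemma 9, ultrametric**: on the unit disc, if `‖Λ₀‖ ≤ p⁻¹` then
`‖f_{J,τ}(z) − φ_{J,τ}(z)‖ ≤ Q · ‖Λ₀‖` (`Q ≥ ‖Dw‖` on the box), because
`termF − termΦ = Dw · A · exp(ψ z) · (exp(λ_θ Λ₀ z) − 1)` and `‖exp w − 1‖ = ‖w‖ ≤ ‖Λ₀‖`.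
[cite: CijsouwWaldschmidt1977, §4 Lemma 9 (p. 187)] [cite: Yu1990, Lemma 2.3] -/
theorem norm_F_sub_Φ_le (J₀ J : ℕ) (box : Finset (Idx S.d h Lb)) (pv : Idx S.d h Lb → ℤ)
    (τ : Tau S.d) (hΛ : ‖S.Λ₀‖ ≤ (p : ℝ)⁻¹) {z : ℚ_[p]} (hz : ‖z‖ ≤ 1) {Q : ℝ} (hQ0 : 0 ≤ Q)
    (hQ : ∀ u ∈ box, ‖S.Dw J₀ J u τ.1 z‖ ≤ Q) :
    ‖S.F J₀ J box pv τ z - S.Φ J₀ J box pv τ z‖ ≤ Q * ‖S.Λ₀‖ := by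
  unfold F Φ
  rw [← sum_sub_distrib]
  refine IsUltrametricDist.norm_sum_le_of_forall_le_of_nonneg (by positivity) fun u hu => ?_
  have hψz : ‖S.ψ u * z‖ ≤ (p : ℝ)⁻¹ := by
    rw [norm_mul]; exact (mul_le_of_le_one_right (norm_nonneg _) hz).trans (S.norm_ψ_le u)
  have hδ : ‖(u.2.2 : ℚ_[p]) * S.Λ₀ * z‖ ≤ ‖S.Λ₀‖ := by
    rw [norm_mul]; exact (mul_le_of_le_one_right (norm_nonneg _) hz).trans (S.norm_natCast_mul_Λ₀_le _)
  have hδ' : ‖(u.2.2 : ℚ_[p]) * S.Λ₀ * z‖ ≤ (p : ℝ)⁻¹ := hδ.trans hΛ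
  have e : (pv u : ℚ_[p]) * S.termF J₀ J u τ z - (pv u : ℚ_[p]) * S.termΦ J₀ J u τ z =
      (pv u : ℚ_[p]) * (S.Dw J₀ J u τ.1 z * S.A u τ.2 * exp (S.ψ u * z)) *
        (exp ((u.2.2 : ℚ_[p]) * S.Λ₀ * z) - 1) := by
    simp only [termF, termΦ, expo]
    rw [show (S.ψ u + (u.2.2 : ℚ_[p]) * S.Λ₀) * z = S.ψ u * z + (u.2.2 : ℚ_[p]) * S.Λ₀ * z by ring,
      PadicExp.exp_add_of_norm_le S.hp3 hψz hδ']
    ring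
  rw [e, norm_mul, norm_mul, norm_mul, norm_mul, PadicExp.norm_exp_of_norm_le S.hp3 hψz, mul_one,
    PadicExp.norm_exp_sub_one_of_norm_le S.hp3 hδ']
  calc ‖(pv u : ℚ_[p])‖ * (‖S.Dw J₀ J u τ.1 z‖ * ‖S.A u τ.2‖) * ‖(u.2.2 : ℚ_[p]) * S.Λ₀ * z‖
      ≤ 1 * (Q * 1) * ‖S.Λ₀‖ := by
        refine mul_le_mul ?_ hδ (norm_nonneg _) (by positivity)
        refine mul_le_mul (Padic.norm_int_le_one _) ?_ (by positivity) zero_le_one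
        exact mul_le_mul (hQ u hu) (S.norm_A_le τ.2 u) (norm_nonneg _) hQ0
    _ = Q * ‖S.Λ₀‖ := by ring

end TwistSetup

end Summit.ABC.StewartYu

end
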